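import Literature.Barriers.SmoothPoincare4.ExoticOpenFourSpaceEndPeriodicProofs
import Mathlib.Topology.Maps.OpenQuotient
import HarnessLib

/-!
# `deMichelisFreedman1992_continuum`: the orbit space `Y` of the end-periodic end is a compact Hausdorff space (§0, §2)

Proof file (definitions of the orbit relation and orbit space + theorems; sibling of
`ExoticOpenFourSpaceEndPeriodicProofs`) in the cone of the named fact
`Literature.Barriers.SmoothPoincare4.deMichelisFreedman1992_continuum` (DeMichelis–Freedman 1992,
Thm. 4.1 with Cor. 4.1).

`ExoticOpenFourSpaceEndPeriodicProofs` renders the end that a diffeomorphism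
`(R⁴_s, K) ≅ (R⁴_t, K)`, `s < t`, produces (first paragraph of the proof of Thm. 4.1, p. 247,
"this allows the construction of end periodic metrics"): the self-map `σ = incl ∘ d⁻¹` of
`X = R⁴_t`, the end compactum `⋂ₖ σ^[k](X)`, the covering action by the monoid `{σ, σ², …}` on
its complement with fundamental domains `X ∖ σ(X)` and `C ∖ σ(C)`, and Taubes' height function
`τ`. The source then passes to "the quotient `Y`" (§0, p. 220: "`R⁴_t ∖ ⋂ₙ dⁿ(R⁴_t)` has a
'covering' action by the monoid `{d, d², d³, …}`; the quotient `Y` is a smooth manifold"; §2,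
p. 223: "The quotient `Y = (R⁴ ∖ ⋂_{k ≥ 1} R⁴_k)/pt ∼ d(pt)` has a natural smooth structure,
which can be described as `C ∖ d(C)/pt ∼ d(pt)`. Give `Y` a fixed Riemannian metric."). THIS
FILE constructs `Y` as a topological space and proves what of those sentences is topology:

* `EndPeriodic.orbitSetoid`, `EndPeriodic.OrbitSpace` — the orbit relation (`x ∼ y` iff
  `σ^[m] x = σ^[n] y` for some `m, n`: the equivalence relation generated by `pt ∼ σ(pt)`) on the
  complement `EndPeriodic.EndCompl σ` of the end compactum, and its quotient `Y` with the
  quotient topology;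
* `EndPeriodic.mk_eq_mk_iff` — two points have the same image in `Y` iff one is an iterate of
  the other; `EndPeriodic.bijOn_mk` — the compact fundamental domain `C ∖ σ(C)` maps
  bijectively onto `Y` ("can be described as `C ∖ d(C)/pt ∼ d(pt)`");
* `EndPeriodic.isOpenMap_mk`, `isOpenQuotientMap_mk` — the projection is an open quotient map;
* `EndPeriodic.compactSpace_orbitSpace` — `Y` is compact (the continuous image of the compact
  set `C ∖ σ²(X) ⊇ C ∖ σ(C)`);
* `EndPeriodic.t2Space_orbitSpace` — `Y` is Hausdorff: the orbit relation is the union of the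
  closed graphs `{x = σ^[j] y}`, `{y = σ^[j] x}`, a family which is locally finite because the
  height function satisfies `τ (σ^[j] y) = τ y + j` (`EndPeriodic.apply_iterate_eq_add_of_shift`)
  and is continuous;
* `compactSpace_orbitSpace_inclusion_comp_symm`, `t2Space_orbitSpace_inclusion_comp_symm`,
  `bijOn_mk_inclusion_comp_symm` — the same for the polar family of the tree's reduction
  (`σ = incl ∘ d⁻¹` for a diffeomorphism `d : R⁴_s ≅ R⁴_t`, `C` the closed polar ball).

NOT rendered (absent from Mathlib): the smooth structure on `Y` (a quotient manifold), its
Riemannian metric and the end-periodic metrics `B_n`, `Q_n`, `M_∞`; and the gauge theory. No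
named fact is introduced (D-0026).

## References

* S. DeMichelis, M. H. Freedman, *Uncountably many exotic `R⁴`'s in standard 4-space*,
  J. Differential Geom. 35 (1992) 219–254: §0 (p. 220), §2 (pp. 222–223), proof of Thm. 4.1
  (p. 247) [DeMichelisFreedman1992].

[DeMichelisFreedman1992]
-/

noncomputable section

open scoped Manifold ContDiff Topology
open TopologicalSpace Set Function Filter Topology

namespace Literature.Barriers.SmoothPoincare4

namespace EndPeriodic

variable {X : Type*} {σ : X → X} {C : Set X}

/-- `σ^[j] x` lies in the end compactum iff `x` does (`σ` injective). [folklore] -/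
theorem iterate_apply_mem_iInter_range_iterate_iff (hinj : Injective σ) (j : ℕ) {x : X} :
    σ^[j] x ∈ ⋂ k, range (σ^[k]) ↔ x ∈ ⋂ k, range (σ^[k]) := by
  induction j with
  | zero => rfl
  | succ j ih => rw [Function.iterate_succ_apply', apply_mem_iInter_range_iterate_iff hinj, ih]

/-- **The shift law along iterates**: `τ (σ^[j] x) = τ x + j` off the end compactum, for any
function with `τ (σ x) = τ x + 1` there. [cite: DeMichelisFreedman1992, §2 (p. 223)] -/
theorem apply_iterate_eq_add_of_shift (hinj : Injective σ) {τ : X → ℝ}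
    (h : ∀ x, x ∉ (⋂ k, range (σ^[k])) → τ (σ x) = τ x + 1) :
    ∀ (j : ℕ) (x : X), x ∉ (⋂ k, range (σ^[k])) → τ (σ^[j] x) = τ x + j
  | 0, x, _ => by simp
  | j + 1, x, hx => by
    have hx' : σ^[j] x ∉ ⋂ k, range (σ^[k]) :=
      fun h' => hx ((iterate_apply_mem_iInter_range_iterate_iff hinj j).1 h')
    rw [Function.iterate_succ_apply', h _ hx', apply_iterate_eq_add_of_shift hinj h j x hx]
    push_cast
    ring

/-! #### The orbit space -/

/-- The complement of the end compactum `⋂ₖ σ^[k](X)` ("`R⁴_t ∖ ⋂ₙ dⁿ(R⁴_t)`", §0), as a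
type. [cite: DeMichelisFreedman1992, §0 (p. 220)] -/
abbrev EndCompl (σ : X → X) : Type _ := {x : X // x ∈ (⋂ k, range (σ^[k]))ᶜ}

/-- **The orbit relation of the covering action by the monoid `{σ, σ², …}`** on the complement of
the end compactum: `x ∼ y` iff some iterates agree, `σ^[m] x = σ^[n] y` ("`pt ∼ d(pt)`", §2; the
equivalence relation generated by `x ∼ σ x`). [cite: DeMichelisFreedman1992, §0 (p. 220), §2 (p. 223)] -/
def orbitSetoid (σ : X → X) : Setoid (EndCompl σ) where
  r x y := ∃ m n : ℕ, σ^[m] (x : X) = σ^[n] (y : X)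
  iseqv :=
    { refl := fun _ => ⟨0, 0, rfl⟩
      symm := fun ⟨m, n, h⟩ => ⟨n, m, h.symm⟩
      trans := fun ⟨m, n, h₁⟩ ⟨m', n', h₂⟩ => ⟨m' + m, n + n', by
        rw [Function.iterate_add_apply, h₁, ← Function.iterate_add_apply, Nat.add_comm m' n,
          Function.iterate_add_apply, h₂, ← Function.iterate_add_apply]⟩ }

/-- **The orbit space `Y = (X ∖ ⋂ₖ σ^[k](X)) / (pt ∼ σ(pt))`** ("the quotient `Y`", §0, p. 220;
"`Y = (R⁴ ∖ ⋂ R⁴_k)/pt ∼ d(pt)`", §2, p. 223), with the quotient topology. The source asserts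
that `Y` is a smooth manifold; below it is shown to be a compact Hausdorff space, the open
quotient of the complement of the end compactum, in bijection with the compact fundamental domain
`C ∖ σ(C)`. [cite: DeMichelisFreedman1992, §0 (p. 220), §2 (p. 223)] -/
abbrev OrbitSpace (σ : X → X) : Type _ := Quotient (orbitSetoid σ)

/-- Two points of the complement of the end compactum have the same image in `Y` iff one is an
iterate of the other (`σ` injective). [cite: DeMichelisFreedman1992, §2 (p. 223)] -/
theorem mk_eq_mk_iff (hinj : Injective σ) {x y : EndCompl σ} :
    (Quotient.mk (orbitSetoid σ) x : OrbitSpace σ) = Quotient.mk (orbitSetoid σ) y ↔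
      (∃ j, (x : X) = σ^[j] y) ∨ ∃ j, (y : X) = σ^[j] x := by
  constructor
  · intro h
    obtain ⟨m, n, h⟩ := Quotient.exact h
    rcases le_total m n with hmn | hnm
    · obtain ⟨j, rfl⟩ := Nat.exists_eq_add_of_le hmn
      refine Or.inl ⟨j, hinj.iterate m ?_⟩
      rw [h, Function.iterate_add_apply]
    · obtain ⟨j, rfl⟩ := Nat.exists_eq_add_of_le hnm
      refine Or.inr ⟨j, hinj.iterate n ?_⟩
      rw [← h, Function.iterate_add_apply]
  · rintro (⟨j, h⟩ | ⟨j, h⟩)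
    · exact Quotient.sound ⟨0, j, h⟩
    · exact Quotient.sound ⟨j, 0, h.symm⟩

/-- **The compact fundamental domain maps bijectively onto the orbit space** ("`Y` … can be
described as `C ∖ d(C)/pt ∼ d(pt)`", §2): the projection restricted to (the trace of) `C ∖ σ(C)`
is a bijection onto `Y` (`σ` injective, `σ(X) ⊆ C`). [cite: DeMichelisFreedman1992, §2 (p. 223)] -/
theorem bijOn_mk (hinj : Injective σ) (hσC : range σ ⊆ C) :
    BijOn (Quotient.mk (orbitSetoid σ) : EndCompl σ → OrbitSpace σ)
      (Subtype.val ⁻¹' (C \ σ '' C)) univ := by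
  refine ⟨mapsTo_univ _ _, ?_, ?_⟩
  · intro y₁ hy₁ y₂ hy₂ h
    obtain ⟨m, n, h⟩ := Quotient.exact h
    exact Subtype.ext (eq_of_mem_diff_image_of_iterate_apply_eq hinj hσC hy₁ hy₂ h)
  · intro q _
    induction q using Quotient.inductionOn with
    | h x =>
      obtain ⟨y, ⟨hyC, m, n, h⟩, -⟩ := existsUnique_mem_diff_image hinj hσC (x := (x : X)) x.2
      have hy : y ∈ (⋂ k, range (σ^[k]))ᶜ :=
        diff_range_iterate_two_subset_compl C σ (diff_image_subset_diff_range_iterate_two hσC hyC)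
      exact ⟨⟨y, hy⟩, hyC, Quotient.sound ⟨n, m, h.symm⟩⟩

variable [TopologicalSpace X]

/-- The projection to the orbit space is continuous. [folklore] -/
theorem continuous_mk : Continuous (Quotient.mk (orbitSetoid σ) : EndCompl σ → OrbitSpace σ) :=
  continuous_quotient_mk'

/-- **The projection to the orbit space is open** (saturations of open sets,
`⋃ₘₙ σ^[-m](σ^[n](U))`, are open because `σ` is an open embedding), provided the end compactum
is closed. [cite: DeMichelisFreedman1992, §0 (p. 220)] -/
theorem isOpenMap_mk (hσ : IsOpenEmbedding σ) (hopen : IsOpen (⋂ k, range (σ^[k]))ᶜ) :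
    IsOpenMap (Quotient.mk (orbitSetoid σ) : EndCompl σ → OrbitSpace σ) := by
  intro U hU
  change IsOpen ((Quotient.mk (orbitSetoid σ)) ⁻¹' (Quotient.mk (orbitSetoid σ) '' U))
  have hval : IsOpen (Subtype.val '' U : Set X) := hopen.isOpenMap_subtype_val U hU
  have key : (Quotient.mk (orbitSetoid σ)) ⁻¹' (Quotient.mk (orbitSetoid σ) '' U) =
      (Subtype.val ⁻¹' ⋃ (m : ℕ) (n : ℕ), (σ^[m]) ⁻¹' (σ^[n] '' (Subtype.val '' U)) :
        Set (EndCompl σ)) := by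
    ext y
    simp only [mem_preimage, mem_image, mem_iUnion]
    constructor
    · rintro ⟨u, hu, hy⟩
      obtain ⟨m, n, h⟩ := Quotient.exact hy
      exact ⟨n, m, u, ⟨u, hu, rfl⟩, h⟩
    · rintro ⟨m, n, _, ⟨u, hu, rfl⟩, h⟩
      exact ⟨u, hu, Quotient.sound ⟨n, m, h⟩⟩
  rw [key]
  refine (isOpen_iUnion fun m => isOpen_iUnion fun n => ?_).preimage continuous_subtype_val
  exact ((isOpenEmbedding_iterate hσ n).isOpenMap _ hval).preimage (hσ.continuous.iterate m)

/-- The projection to the orbit space is an open quotient map. [folklore] -/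
theorem isOpenQuotientMap_mk (hσ : IsOpenEmbedding σ) (hopen : IsOpen (⋂ k, range (σ^[k]))ᶜ) :
    IsOpenQuotientMap (Quotient.mk (orbitSetoid σ) : EndCompl σ → OrbitSpace σ) :=
  ⟨Quotient.mk_surjective, continuous_mk, isOpenMap_mk hσ hopen⟩

/-- **The orbit space is compact**: it is the continuous image of the compact set `C ∖ σ²(X)`
(which contains the fundamental domain `C ∖ σ(C)` and misses the end compactum), for `σ` an open
embedding of a Hausdorff space with `σ(X) ⊆ C` compact. [cite: DeMichelisFreedman1992, §0 (p. 220), §2 (p. 223)] -/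
theorem compactSpace_orbitSpace [T2Space X] (hσ : IsOpenEmbedding σ) (hC : IsCompact C)
    (hσC : range σ ⊆ C) : CompactSpace (OrbitSpace σ) := by
  set D : Set (EndCompl σ) := Subtype.val ⁻¹' (C \ range (σ^[2])) with hD_def
  have hD : IsCompact D := by
    rw [Subtype.isCompact_iff, image_preimage_eq_inter_range, Subtype.range_coe_subtype,
      setOf_mem_eq, inter_eq_left.2 (diff_range_iterate_two_subset_compl C σ)]
    exact isCompact_diff_range_iterate_two hσ hC
  have hsurj : (Quotient.mk (orbitSetoid σ) : EndCompl σ → OrbitSpace σ) '' D = univ := by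
    refine eq_univ_of_forall fun q => ?_
    obtain ⟨y, hy, hq⟩ := (bijOn_mk hσ.injective hσC).surjOn (mem_univ q)
    exact ⟨y, diff_image_subset_diff_range_iterate_two hσC hy, hq⟩
  refine ⟨?_⟩
  rw [← hsurj]
  exact hD.image continuous_mk

/-- **The orbit space is Hausdorff** (`σ` an open embedding of a locally compact Hausdorff space
with `σ(X) ⊆ C` compact). The projection is an open quotient map, so it suffices that the orbit
relation be closed in `(X ∖ ⋂ₖ σ^[k](X))²`; by `mk_eq_mk_iff` it is the union of the graphs
`{x = σ^[j] y}`, `{y = σ^[j] x}`, `j ∈ ℕ`, each closed, and this family is locally finite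
because Taubes' height function `τ` (`exists_height_function`) is continuous with
`τ (σ^[j] y) = τ y + j`, which bounds `j` near any point. [cite: DeMichelisFreedman1992, §0 (p. 220), §2 (p. 223)] -/
theorem t2Space_orbitSpace [T2Space X] [LocallyCompactSpace X] (hσ : IsOpenEmbedding σ)
    (hC : IsCompact C) (hσC : range σ ⊆ C) : T2Space (OrbitSpace σ) := by
  have hopen : IsOpen (⋂ k, range (σ^[k]))ᶜ :=
    (isClosed_iInter_range_iterate hσ.continuous hC hσC).isOpen_compl
  rw [t2Space_iff_of_isOpenQuotientMap (isOpenQuotientMap_mk hσ hopen)]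
  obtain ⟨τ, hτc, -, hshift, -, -⟩ := exists_height_function hσ hC hσC
  have hshiftj := apply_iterate_eq_add_of_shift hσ.injective hshift
  have hτ : Continuous fun x : EndCompl σ => τ x :=
    hτc.comp_continuous continuous_subtype_val fun x => x.2
  -- the graphs `x = σ^[j] y`
  set A : ℕ → Set (EndCompl σ × EndCompl σ) := fun j => {q | (q.1 : X) = σ^[j] q.2} with hA
  have hAclosed : ∀ j, IsClosed (A j) := fun j =>
    isClosed_eq (continuous_subtype_val.comp continuous_fst)
      ((hσ.continuous.iterate j).comp (continuous_subtype_val.comp continuous_snd))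
  have hAfin : LocallyFinite A := by
    intro q₀
    refine ⟨{q | τ q₀.2 - 1 < τ q.2 ∧ τ q.1 < τ q₀.1 + 1}, ?_, ?_⟩
    · refine IsOpen.mem_nhds ?_ ⟨by linarith, by linarith⟩
      exact (isOpen_lt continuous_const (hτ.comp continuous_snd)).inter
        (isOpen_lt (hτ.comp continuous_fst) continuous_const)
    · refine (Set.finite_Iio ⌈τ q₀.1 - τ q₀.2 + 2⌉₊).subset ?_
      rintro j ⟨q, hqA, hq1, hq2⟩
      have hj : τ (σ^[j] q.2) = τ q.2 + j := hshiftj j q.2 q.2.2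
      have hqA' : (q.1 : X) = σ^[j] q.2 := hqA
      rw [← hqA'] at hj
      rw [mem_Iio, Nat.lt_ceil]
      linarith
  -- the graphs `y = σ^[j] x`
  set B : ℕ → Set (EndCompl σ × EndCompl σ) := fun j => {q | (q.2 : X) = σ^[j] q.1} with hB
  have hBclosed : ∀ j, IsClosed (B j) := fun j => (hAclosed j).preimage continuous_swap
  have hBfin : LocallyFinite B := hAfin.preimage_continuous continuous_swap
  have key : {q : EndCompl σ × EndCompl σ |
      (Quotient.mk (orbitSetoid σ) q.1 : OrbitSpace σ) = Quotient.mk (orbitSetoid σ) q.2} =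
      (⋃ j, A j) ∪ ⋃ j, B j := by
    ext q
    simp only [mem_setOf_eq, mem_union, mem_iUnion]
    exact mk_eq_mk_iff hσ.injective
  rw [key]
  exact (hAfin.isClosed_iUnion hAclosed).union (hBfin.isClosed_iUnion hBclosed)

end EndPeriodic

/-! ### The orbit space of the end produced by a diffeomorphism `R⁴_s ≅ R⁴_t` -/

section PolarOrbitSpace

variable {E : Type*} [NormedAddCommGroup E] [NormedSpace ℝ E]
  {R : Opens E} {e : R ≃ₜ E} {s t : ℝ}

/-- **The orbit space `Y` of §0 for the polar family is compact**: for a diffeomorphism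
`d : R⁴_s ≅ R⁴_t`, `s < t`, `s < 1`, the orbit space of the self-map `σ = incl ∘ d⁻¹` of `R⁴_t`
(`exists_endPeriodicEnd_of_diffeomorph`) is compact. [cite: DeMichelisFreedman1992, §0 (p. 220), §2 (p. 223)] -/
theorem compactSpace_orbitSpace_inclusion_comp_symm [ProperSpace E] (hst : s < t) (hs1 : s < 1)
    (d : polarBall R e s ≃ₘ⟮𝓘(ℝ, E), 𝓘(ℝ, E)⟯ polarBall R e t) :
    CompactSpace
      (EndPeriodic.OrbitSpace (Opens.inclusion (polarBall_mono R e hst.le) ∘ d.symm)) :=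
  EndPeriodic.compactSpace_orbitSpace (isOpenEmbedding_inclusion_comp_symm hst.le d)
    (isCompact_preimage_val_setOf_mul_norm_le R e hst hs1)
    (range_inclusion_comp_symm_subset hst.le d)

/-- **The orbit space `Y` of §0 for the polar family is Hausdorff.** [cite: DeMichelisFreedman1992, §0 (p. 220), §2 (p. 223)] -/
theorem t2Space_orbitSpace_inclusion_comp_symm [ProperSpace E] (hst : s < t) (hs1 : s < 1)
    (d : polarBall R e s ≃ₘ⟮𝓘(ℝ, E), 𝓘(ℝ, E)⟯ polarBall R e t) :
    T2Space (EndPeriodic.OrbitSpace (Opens.inclusion (polarBall_mono R e hst.le) ∘ d.symm)) := by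
  haveI : LocallyCompactSpace (polarBall R e t) := (polarBall R e t).isOpen.locallyCompactSpace
  exact EndPeriodic.t2Space_orbitSpace (isOpenEmbedding_inclusion_comp_symm hst.le d)
    (isCompact_preimage_val_setOf_mul_norm_le R e hst hs1)
    (range_inclusion_comp_symm_subset hst.le d)

/-- **The compact fundamental domain `C ∖ σ(C)` of the polar end maps bijectively onto `Y`**,
`C = {(1 - s) ‖e ·‖ ≤ 1}` the closed polar ball ("`Y` … can be described as
`C ∖ d(C)/pt ∼ d(pt)`"). [cite: DeMichelisFreedman1992, §2 (p. 223)] -/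
theorem bijOn_mk_inclusion_comp_symm (hst : s ≤ t)
    (d : polarBall R e s ≃ₘ⟮𝓘(ℝ, E), 𝓘(ℝ, E)⟯ polarBall R e t) :
    BijOn (Quotient.mk (EndPeriodic.orbitSetoid (Opens.inclusion (polarBall_mono R e hst) ∘ d.symm)))
      (Subtype.val ⁻¹' ((Subtype.val ⁻¹' {x : E | ∃ hx : x ∈ R, (1 - s) * ‖e ⟨x, hx⟩‖ ≤ 1}) \
        (Opens.inclusion (polarBall_mono R e hst) ∘ d.symm) ''
          (Subtype.val ⁻¹' {x : E | ∃ hx : x ∈ R, (1 - s) * ‖e ⟨x, hx⟩‖ ≤ 1})))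
      univ :=
  EndPeriodic.bijOn_mk (isOpenEmbedding_inclusion_comp_symm hst d).injective
    (range_inclusion_comp_symm_subset hst d)

end PolarOrbitSpace

end Literature.Barriers.SmoothPoincare4

end
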